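import Summits.ResolutionOfSingularities.ResolutionOfSingularities.Theorems.WeightedInvariantIota3SigmaAscent
import HarnessLib

/-!
# DESCENT of reached weights along `S → S(X)` by SPECIALISATION `X ↦ a` — the reduction to a good point ((o39) sequel, (D-b) steps 1–4)

Route `ResolutionOfSingularities/WeightedInvariant`, crux `Theses.WeightedInvariant.HypersurfaceCentreConstruction`
(stmt-ResolutionOfSingularities-19897), P3 rung, clause (c10σ); res-L1-w43-plan-1 RULING gen 11 #5 (2) Q2 («descent for infinite residue
field by specialisation X ↦ a»), design note `plan/tools/res-type-057/SIGMA-DESCENT-SX.md` (res-type-057).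

For `f ∈ S` (local) and a flag of `S(X) = S[X]_{𝔪S[X]}` carrying `C f` to level `r₁ν` of its `(q; r₁, r₂)`-filtration, this file produces
POLYNOMIALS `G₁, G₂, s ∈ S[X]` (`s ∉ 𝔪S[X]`) such that for EVERY `a ∈ S` with `s(a)` a unit and `(G₁(a), G₂(a))` a two-flag of `S`,
`FlagReaches f ν q r₁ r₂` holds downstairs (`FlagReaches.of_genericFibre_of_goodPoint`).  Steps: unit scaling of flags
(`flagContactFiltration_unit_mul_left/right`, `IsTwoFlag.unit_mul_left/right`), the two-flag filtration of fractions `Gᵢ/1` as the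
extension of an explicit ideal of `S[X]` (`flagContactFiltration_algebraMap_eq_map`), pull-back of membership to `S[X]` up to a
denominator (`IsLocalization.algebraMap_mem_map_algebraMap_iff`), and specialisation (`map_flagIdeal_aeval_le`: evaluation at `a` maps
`𝔪S[X]` onto `𝔪` and the explicit ideal into the two-flag filtration of `(G₁(a), G₂(a))`).  The remaining step (D-b)(5) — the
EXISTENCE of a good `a` when the residue field is infinite (finitely many bad residues: roots of `s̄` and of a cotangent minor) — and the
finite-field reduction (D-c) are NOT in this file.

Def-free helper (`--supports stmt-ResolutionOfSingularities-19897`); OURS bookkeeping; no claim about resolution in positive characteristic.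
AI-written; weaker than expert review.  [OURS · L1 W4.3 · (o39) sequel]  [cite: Matsumura1987, §8 (localisation and flatness)]
-/

noncomputable section

set_option linter.dupNamespace false -- mandated namespace of this single-conjunct summit

open IsLocalRing Polynomial Literature.AlgebraicGeometry.Resolution
open Summit.ResolutionOfSingularities.ResolutionOfSingularities.Theorems

namespace Summit.ResolutionOfSingularities.ResolutionOfSingularities.Cruxes.HypersurfaceCentreConstruction.LocalEngine

namespace Iota3

universe u

/-! ## §1 Unit scaling of flags -/

section Unit

variable {T : Type u} [CommRing T] [IsLocalRing T]

/-- Scaling `g₁` by a unit does not change the two-flag filtration. [folklore] -/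
theorem flagContactFiltration_unit_mul_left {u : T} (hu : IsUnit u) (g₁ g₂ : T) (q r₁ r₂ n : ℕ) :
    flagContactFiltration (u * g₁) g₂ q r₁ r₂ n = flagContactFiltration g₁ g₂ q r₁ r₂ n := by
  rw [flagContactFiltration_def, flagContactFiltration_def]
  refine iSup_congr fun α => iSup_congr fun β => ?_
  rw [mul_pow, mul_assoc, Ideal.span_singleton_mul_left_unit (hu.pow α)]

/-- Scaling `g₂` by a unit does not change the two-flag filtration. [folklore] -/
theorem flagContactFiltration_unit_mul_right {v : T} (hv : IsUnit v) (g₁ g₂ : T) (q r₁ r₂ n : ℕ) :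
    flagContactFiltration g₁ (v * g₂) q r₁ r₂ n = flagContactFiltration g₁ g₂ q r₁ r₂ n := by
  rw [flagContactFiltration_def, flagContactFiltration_def]
  refine iSup_congr fun α => iSup_congr fun β => ?_
  rw [mul_pow, mul_left_comm, Ideal.span_singleton_mul_left_unit (hv.pow β)]

/-- Scaling `g₁` by a unit preserves two-flags. [folklore] -/
theorem IsTwoFlag.unit_mul_left {u g₁ g₂ : T} (hu : IsUnit u) (h : IsTwoFlag g₁ g₂) : IsTwoFlag (u * g₁) g₂ := by
  refine ⟨Ideal.mul_mem_left _ u h.1, h.2.1, fun a b hab => ?_⟩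
  obtain ⟨ha, hb⟩ := h.2.2 (a * u) b (by rwa [mul_assoc])
  exact ⟨(Ideal.unit_mul_mem_iff_mem _ hu).mp (by rwa [mul_comm] at ha), hb⟩

/-- Scaling `g₂` by a unit preserves two-flags. [folklore] -/
theorem IsTwoFlag.unit_mul_right {v g₁ g₂ : T} (hv : IsUnit v) (h : IsTwoFlag g₁ g₂) : IsTwoFlag g₁ (v * g₂) := by
  refine ⟨h.1, Ideal.mul_mem_left _ v h.2.1, fun a b hab => ?_⟩
  obtain ⟨ha, hb⟩ := h.2.2 a (b * v) (by rwa [mul_assoc])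
  exact ⟨ha, (Ideal.unit_mul_mem_iff_mem _ hv).mp (by rwa [mul_comm] at hb)⟩

end Unit

/-! ## §2 The two-flag filtration of fractions and its pull-back to `S[X]` -/

section Fibre

variable {S : Type} [CommRing S] [IsLocalRing S]

/-- The two-flag filtration of `(G₁/1, G₂/1)` in `S(X)` is the extension of the explicit `S[X]`-ideal
`⨆_{α β} (G₁^α G₂^β)·(𝔪S[X])^{⌈(n − r₁α − r₂β)/q⌉}`. [folklore] -/
theorem flagContactFiltration_algebraMap_eq_map (G₁ G₂ : S[X]) (q r₁ r₂ n : ℕ) :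
    flagContactFiltration (algebraMap S[X] (Localization.AtPrime ((maximalIdeal S).map (C : S →+* S[X]))) G₁)
        (algebraMap S[X] (Localization.AtPrime ((maximalIdeal S).map (C : S →+* S[X]))) G₂) q r₁ r₂ n =
      (⨆ α : ℕ, ⨆ β : ℕ, Ideal.span {G₁ ^ α * G₂ ^ β} *
        ((maximalIdeal S).map (C : S →+* S[X])) ^ ((n - r₁ * α - r₂ * β + q - 1) / q)).map
        (algebraMap S[X] (Localization.AtPrime ((maximalIdeal S).map (C : S →+* S[X])))) := by
  rw [flagContactFiltration_def, Ideal.map_iSup]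
  refine iSup_congr fun α => ?_
  rw [Ideal.map_iSup]
  refine iSup_congr fun β => ?_
  rw [Ideal.map_mul, Ideal.map_pow, Ideal.map_span, Set.image_singleton, map_mul, map_pow, map_pow,
    Localization.AtPrime.map_eq_maximalIdeal]

/-- **Pull-back to `S[X]` up to a denominator**: membership of `F/1` in the two-flag filtration of `(G₁/1, G₂/1)` means
`s·F` lies in the explicit `S[X]`-ideal for some `s ∉ 𝔪S[X]`. [folklore] -/
theorem exists_mul_mem_of_algebraMap_mem_flagContactFiltration (G₁ G₂ F : S[X]) (q r₁ r₂ n : ℕ)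
    (h : algebraMap S[X] (Localization.AtPrime ((maximalIdeal S).map (C : S →+* S[X]))) F ∈
      flagContactFiltration (algebraMap S[X] (Localization.AtPrime ((maximalIdeal S).map (C : S →+* S[X]))) G₁)
        (algebraMap S[X] (Localization.AtPrime ((maximalIdeal S).map (C : S →+* S[X]))) G₂) q r₁ r₂ n) :
    ∃ s : S[X], s ∉ (maximalIdeal S).map (C : S →+* S[X]) ∧
      s * F ∈ ⨆ α : ℕ, ⨆ β : ℕ, Ideal.span {G₁ ^ α * G₂ ^ β} *
        ((maximalIdeal S).map (C : S →+* S[X])) ^ ((n - r₁ * α - r₂ * β + q - 1) / q) := by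
  rw [flagContactFiltration_algebraMap_eq_map,
    IsLocalization.algebraMap_mem_map_algebraMap_iff ((maximalIdeal S).map (C : S →+* S[X])).primeCompl] at h
  obtain ⟨s, hs, hsF⟩ := h
  exact ⟨s, hs, hsF⟩

/-! ## §3 Specialisation `X ↦ a` -/

/-- Evaluation at `a ∈ S` sends `𝔪S[X]` onto `𝔪`. [folklore] -/
theorem map_aeval_map_C_maximalIdeal (a : S) :
    ((maximalIdeal S).map (C : S →+* S[X])).map (Polynomial.aeval a).toRingHom = maximalIdeal S := by
  rw [Ideal.map_map]
  have h : (Polynomial.aeval a).toRingHom.comp (C : S →+* S[X]) = RingHom.id S := by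
    ext x
    simp
  rw [h, Ideal.map_id]

/-- Evaluation at `a` maps the explicit `S[X]`-ideal into the two-flag filtration of `(G₁(a), G₂(a))`. [folklore] -/
theorem map_flagIdeal_aeval_le (a : S) (G₁ G₂ : S[X]) (q r₁ r₂ n : ℕ) :
    (⨆ α : ℕ, ⨆ β : ℕ, Ideal.span {G₁ ^ α * G₂ ^ β} *
        ((maximalIdeal S).map (C : S →+* S[X])) ^ ((n - r₁ * α - r₂ * β + q - 1) / q)).map (Polynomial.aeval a).toRingHom ≤
      flagContactFiltration (Polynomial.aeval a G₁) (Polynomial.aeval a G₂) q r₁ r₂ n := by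
  rw [flagContactFiltration_def, Ideal.map_iSup]
  refine iSup_mono fun α => ?_
  rw [Ideal.map_iSup]
  refine iSup_mono fun β => ?_
  rw [Ideal.map_mul, Ideal.map_pow, Ideal.map_span, Set.image_singleton, map_aeval_map_C_maximalIdeal, map_mul, map_pow,
    map_pow]
  rfl

/-- **DESCENT TO A GOOD POINT.**  If a flag of `S(X)` carries `C f` to level `r₁ν` of its `(q; r₁, r₂)`-filtration, there are
polynomials `G₁, G₂ ∈ 𝔪S[X]` and `s ∉ 𝔪S[X]` (with `(G₁/1, G₂/1)` a two-flag of `S(X)` carrying `C f/1` up to the unit `s/1`) such that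
for EVERY `a ∈ S` at which `s(a)` is a unit and `(G₁(a), G₂(a))` is a two-flag of `S`, the weights are reached downstairs:
`FlagReaches f ν q r₁ r₂`. [folklore] -/
theorem FlagReaches.exists_goodPoint_criterion {f : S} {ν q r₁ r₂ : ℕ}
    (h : FlagReaches (algebraMap S[X] (Localization.AtPrime ((maximalIdeal S).map (C : S →+* S[X]))) (C f)) ν q r₁ r₂) :
    ∃ G₁ G₂ s : S[X], s ∉ (maximalIdeal S).map (C : S →+* S[X]) ∧
      IsTwoFlag (algebraMap S[X] (Localization.AtPrime ((maximalIdeal S).map (C : S →+* S[X]))) G₁)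
        (algebraMap S[X] (Localization.AtPrime ((maximalIdeal S).map (C : S →+* S[X]))) G₂) ∧
      s * C f ∈ (⨆ α : ℕ, ⨆ β : ℕ, Ideal.span {G₁ ^ α * G₂ ^ β} *
        ((maximalIdeal S).map (C : S →+* S[X])) ^ ((r₁ * ν - r₁ * α - r₂ * β + q - 1) / q)) ∧
      ∀ a : S, IsUnit (Polynomial.aeval a s) → IsTwoFlag (Polynomial.aeval a G₁) (Polynomial.aeval a G₂) →
        FlagReaches f ν q r₁ r₂ := by
  obtain ⟨g₁, g₂, hfl, hmem⟩ := h
  -- fractions `gᵢ = Gᵢ/tᵢ`; the numerators `Gᵢ/1 = (tᵢ/1)·gᵢ` form a flag with the same filtration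
  obtain ⟨⟨G₁, t₁⟩, hg₁⟩ := IsLocalization.mk'_surjective ((maximalIdeal S).map (C : S →+* S[X])).primeCompl g₁
  obtain ⟨⟨G₂, t₂⟩, hg₂⟩ := IsLocalization.mk'_surjective ((maximalIdeal S).map (C : S →+* S[X])).primeCompl g₂
  simp only at hg₁ hg₂
  have ht₁ : IsUnit (algebraMap S[X] (Localization.AtPrime ((maximalIdeal S).map (C : S →+* S[X]))) t₁) :=
    IsLocalization.map_units _ t₁
  have ht₂ : IsUnit (algebraMap S[X] (Localization.AtPrime ((maximalIdeal S).map (C : S →+* S[X]))) t₂) :=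
    IsLocalization.map_units _ t₂
  have hG₁ : algebraMap S[X] (Localization.AtPrime ((maximalIdeal S).map (C : S →+* S[X]))) G₁ =
      algebraMap S[X] (Localization.AtPrime ((maximalIdeal S).map (C : S →+* S[X]))) t₁ * g₁ := by
    rw [← hg₁, mul_comm, IsLocalization.mk'_spec]
  have hG₂ : algebraMap S[X] (Localization.AtPrime ((maximalIdeal S).map (C : S →+* S[X]))) G₂ =
      algebraMap S[X] (Localization.AtPrime ((maximalIdeal S).map (C : S →+* S[X]))) t₂ * g₂ := by
    rw [← hg₂, mul_comm, IsLocalization.mk'_spec]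
  have hflG : IsTwoFlag (algebraMap S[X] (Localization.AtPrime ((maximalIdeal S).map (C : S →+* S[X]))) G₁)
      (algebraMap S[X] (Localization.AtPrime ((maximalIdeal S).map (C : S →+* S[X]))) G₂) := by
    rw [hG₁, hG₂]
    exact (hfl.unit_mul_left ht₁).unit_mul_right ht₂
  have hmemG : algebraMap S[X] (Localization.AtPrime ((maximalIdeal S).map (C : S →+* S[X]))) (C f) ∈
      flagContactFiltration (algebraMap S[X] (Localization.AtPrime ((maximalIdeal S).map (C : S →+* S[X]))) G₁)
        (algebraMap S[X] (Localization.AtPrime ((maximalIdeal S).map (C : S →+* S[X]))) G₂) q r₁ r₂ (r₁ * ν) := by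
    rw [hG₁, hG₂, flagContactFiltration_unit_mul_left ht₁, flagContactFiltration_unit_mul_right ht₂]
    exact hmem
  obtain ⟨s, hs, hsF⟩ := exists_mul_mem_of_algebraMap_mem_flagContactFiltration G₁ G₂ (C f) q r₁ r₂ (r₁ * ν) hmemG
  refine ⟨G₁, G₂, s, hs, hflG, hsF, fun a hsa hfla => ⟨_, _, hfla, ?_⟩⟩
  -- specialise: `s(a)·f ∈ F_{G₁(a),G₂(a)}(r₁ν)`, and `s(a)` is a unit
  have h1 : (Polynomial.aeval a).toRingHom (s * C f) ∈
      flagContactFiltration (Polynomial.aeval a G₁) (Polynomial.aeval a G₂) q r₁ r₂ (r₁ * ν) :=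
    map_flagIdeal_aeval_le a G₁ G₂ q r₁ r₂ (r₁ * ν) (Ideal.mem_map_of_mem _ hsF)
  rw [map_mul, AlgHom.toRingHom_eq_coe, AlgHom.coe_toRingHom, Polynomial.aeval_C, Algebra.algebraMap_self_apply] at h1
  exact (Ideal.unit_mul_mem_iff_mem _ hsa).mp h1

end Fibre

end Iota3

end Summit.ResolutionOfSingularities.ResolutionOfSingularities.Cruxes.HypersurfaceCentreConstruction.LocalEngine

end
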